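import Summits.BirchSwinnertonDyer.BirchSwinnertonDyer.Theorems.SignedLowerHalvesSmallImageLowerHalfBothSignsLambdaLowerThreeNsKato
import HarnessLib

/-!
# Route `SignedLowerHalves` (K3), child crux L `SmallImageLowerHalfBothSigns` (item stmt-BirchSwinnertonDyer-23599),
# line `birth_acns` v14, stub `stub_lambdaLowerThree_ns` (= retired item 23118 `SmallImageLambdaLowerAtThree`, VERBATIM):
# the λ-seam with Kobayashi's JOINT Coleman–Kato package BY NAME — on class X7 the sign of the λ-stub is IDLE, its currency
# is Kato's `λ(char 𝐇¹(T)/Z(T)) ≤ λ(char X₀)` at every sign, and the λ-DEFECT `λ(L_p^ε) − λ(ξ^ε)` is ONE number per pair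

Cell `bsd-ssimc`, width seat `bsd-line-slh-p3-w3` gen 6 (route-independent helper `--supports stmt-BirchSwinnertonDyer-23599`;
NO `Theses` import; companion of `…LambdaLowerThreeNsKato.lean`, whose §3 carries the joint package as a DISPLAYED hypothesis).
HONEST FRAMING: TOOL THEOREMS ONLY — no definition, no named fact minted, no `sorry`, axioms standard; CONDITIONAL on the
displayed published inputs `h12` (Kobayashi 2003 Thm. 1.2), a period unit at the pair (`hper`: `ord_p ϖ = 0`; Greenberg–Vatsal
Rem. 3.4 / Mazur 1978 Cor. 4.1 in the cone) and the JOINT package fact `Kobayashi2003.thm62_63_73_signedColemanKato_zetaJoint`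
(`hJ`: both signs on ONE zeta submodule `Z(T)`, Kobayashi Thm. 5.2 iv) / proof of Thm. 7.4, with Kato Thm. 12.5/12.6; ACCEPTED
Literature named fact, no `_holds`). The three Tate-module structure facts the package binds are kernel theorems
(`TateModule.continuousSMul_padicInt`, `module_free/finite_tateModule_holds`). Nothing here is an unconditional theorem
about a curve; the stub, crux L and the route stay OPEN; BSD is not proved by any of this.

* `X7.exists_sign_forall_lamLe_iff_forall_sign` — «∃ ε, `λ(L_p^ε) ≤ λ(ξ^ε)` at every frame / Pollack pair / dual datum of
  sign ε» ⟺ «the same at EVERY sign»: the `∀ ε` of the registered λ-stub is its `∃ ε` (class X7, odd `p`, `a_p = 0`, NO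
  image hypothesis).
* `X7.forall_lamLe_iff_kato_allSigns` — for ANY sign, the λ-inequality at that sign ⟺ Kato's λ-inequality
  `λ(z) ≤ λ(y)` (generators of `char(𝐇¹/Z)`, `char X₀`) on EVERY package of EITHER sign: Kato's Conjecture 12.10, λ-part,
  in `Λ ⊗ ℚ_p` — no `±` object.
* `X7.lam_add_lam_eq_of_signs` — `λ(L_p^+) + λ(ξ₋) = λ(L_p^−) + λ(ξ₊)` for all dual data `D₊`, `D₋` on one frame: the EXCESS
  of analytic over algebraic λ is one number per pair (`= λ(char 𝐇¹/Z) − λ(char X₀) ≥ 0` by Kato); the stub asks it to be `0`.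

References: [Kobayashi2003] Thm. 1.2 (p. 2), Thm. 5.2 iv) (p. 9), §5 (p. 10), Thm. 6.2/6.3 (p. 11), Thm. 7.3 i) (7.21),
Thm. 7.4 and its proof (p. 13); [Kato2004Asterisque] Thm. 12.5/12.6 (p. 222), Conj. 12.10 (p. 224); [GreenbergVatsal2000]
p. 4 (1)–(2), §3 Rem. 3.4; [Serre1972] §1.11 Prop. 12; [Pollack2003] Thm. 5.6.
-/

set_option autoImplicit false
-- single-problem summit (D-0017): the doubled namespace component is by design
set_option linter.dupNamespace false

noncomputable section

open scoped Classical MatrixGroups ModularForm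

open CongruenceSubgroup Field WeierstrassCurve Literature.NumberTheory.EllipticCurves
  Literature.NumberTheory.EllipticCurves.ModularForms Literature.NumberTheory.GaloisRepresentations
  Literature.NumberTheory.EllipticCurves.Rank1Residual
  Literature.NumberTheory.EllipticCurves.Rank1Residual.Typed
  Summit.BirchSwinnertonDyer.Rank1Residual.Supersingular
  Summit.BirchSwinnertonDyer.Rank1Residual.X1.MuLambda

namespace Summit.BirchSwinnertonDyer.BirchSwinnertonDyer.Theorems.SmallImageLambdaLowerThreeNsKato

open SignDefect

/-! ## The λ-seam with Kobayashi's joint package BY NAME (Tate-module instances discharged) -/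

section X7Named

variable (W : WeierstrassCurve ℚ) [W.IsElliptic] [W.IsGloballyMinimal] (p : ℕ) [Fact p.Prime]

/-- **The sign of the λ-stub is idle, joint package by name** (class X7, odd `p`, `a_p = 0`): granted Kobayashi Thm. 1.2
(`h12`), a period unit at the pair (`hper`) and the JOINT package fact `Kobayashi2003.thm62_63_73_signedColemanKato_zetaJoint`
(`hJ`): «∃ ε, the λ-inequality `λ(L_p^ε) ≤ λ(ξ^ε)` at every frame / Pollack pair / datum of sign `ε`» ⟺ «the same for EVERY
sign». (`ℤˣ = {1, −1}` and `X7.forall_lamLe_of_jointZ` both ways; the Tate-module structure facts the package binds are kernel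
theorems.) No image hypothesis. [cite: Kobayashi2003, Thm. 5.2 iv) (p. 9), Thm. 7.4 and its proof (p. 13)]
[cite: Serre1972, §1.11 Prop. 12] -/
theorem X7.exists_sign_forall_lamLe_iff_forall_sign
    (h12 : Kobayashi2003.thm12_signedSelmerDual_finite_torsion)
    (hper : ∀ [NeZero (W.conductorNorm ℤ)] (f : CuspForm (Gamma0 (W.conductorNorm ℤ)) 2) (ϖ : ℚ),
      IsNewformOf W f → (ϖ : ℝ) * W.realPeriodRat = plusPeriod f → padicValRat p ϖ = 0)
    (hJ : Kobayashi2003.thm62_63_73_signedColemanKato_zetaJoint)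
    (hp : p ≠ 2) (hX : ClassX7 W p) (hap : W.frobeniusTrace p = 0) :
    (∃ ε : ℤˣ, ∀ (κ : ZpExtension ℚ p) (γ : absoluteGaloisGroup ℚ),
        κ.IsCyclotomic → κ.IsTopGenerator γ → IsCyclotomicVariable p γ →
      ∀ [NeZero (W.conductorNorm ℤ)] (f : CuspForm (Gamma0 (W.conductorNorm ℤ)) 2),
        IsNewformOf W f → ∀ (ϖ : ℚ), (ϖ : ℝ) * W.realPeriodRat = plusPeriod f →
      ∀ (Lplus Lminus : IwasawaAlgebra p), IsPollackPair f p Lplus Lminus →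
      ∀ (D : Kobayashi2003.SignedSelmerDualData W κ γ ε) (ξ : IwasawaAlgebra p),
        D.charIdeal = Ideal.span {ξ} → lam (kobayashiL ε Lplus Lminus) ≤ lam ξ) ↔
    ∀ (ε : ℤˣ) (κ : ZpExtension ℚ p) (γ : absoluteGaloisGroup ℚ),
        κ.IsCyclotomic → κ.IsTopGenerator γ → IsCyclotomicVariable p γ →
      ∀ [NeZero (W.conductorNorm ℤ)] (f : CuspForm (Gamma0 (W.conductorNorm ℤ)) 2),
        IsNewformOf W f → ∀ (ϖ : ℚ), (ϖ : ℝ) * W.realPeriodRat = plusPeriod f →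
      ∀ (Lplus Lminus : IwasawaAlgebra p), IsPollackPair f p Lplus Lminus →
      ∀ (D : Kobayashi2003.SignedSelmerDualData W κ γ ε) (ξ : IwasawaAlgebra p),
        D.charIdeal = Ideal.span {ξ} → lam (kobayashiL ε Lplus Lminus) ≤ lam ξ := by
  haveI : ContinuousSMul ℤ_[p] (W.tateModule p) := TateModule.continuousSMul_padicInt
  haveI : Module.Free ℤ_[p] (W.tateModule p) := W.module_free_tateModule_holds p
  haveI : Module.Finite ℤ_[p] (W.tateModule p) := W.module_finite_tateModule_holds p
  have hJ' : ∀ (ε₁ ε₂ : ℤˣ) (κ : ZpExtension ℚ p) (γ : absoluteGaloisGroup ℚ),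
      κ.IsCyclotomic → κ.IsTopGenerator γ → IsCyclotomicVariable p γ →
      ∀ [NeZero (W.conductorNorm ℤ)] (f : CuspForm (Gamma0 (W.conductorNorm ℤ)) 2),
        IsNewformOf W f → ∀ (ϖ : ℚ), (ϖ : ℝ) * W.realPeriodRat = plusPeriod f →
      ∀ (I : Kato2004.IwasawaH1Data W p κ γ),
        ∃ (d₁ : Kobayashi2003.SignedColemanKatoData W p f ϖ κ γ ε₁ I)
          (d₂ : Kobayashi2003.SignedColemanKatoData W p f ϖ κ γ ε₂ I), d₁.Z = d₂.Z := by
    intro ε₁ ε₂ κ γ hκ hγ hv _ f hf ϖ hϖ I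
    obtain ⟨dp, dm, hZ⟩ := hJ W p f ϖ κ γ hp hX.1.1 hap hf hϖ hκ hγ hv I
    rcases Int.units_eq_one_or ε₁ with rfl | rfl <;> rcases Int.units_eq_one_or ε₂ with rfl | rfl
    · exact ⟨dp, dp, rfl⟩
    · exact ⟨dp, dm, hZ⟩
    · exact ⟨dm, dp, hZ.symm⟩
    · exact ⟨dm, dm, rfl⟩
  refine ⟨fun ⟨ε₀, h⟩ ε ↦ ?_, fun h ↦ ⟨1, h 1⟩⟩
  exact X7.forall_lamLe_of_jointZ W p h12 hper hp hX hap (hJ' ε₀ ε) h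

/-- **Kato currency, sign-free, joint package by name** (class X7, odd `p`, `a_p = 0`; `h12`/`hper`/`hJ`): for ANY sign `ε`,
the λ-inequality `λ(L_p^ε) ≤ λ(ξ^ε)` at every frame / Pollack pair / datum of sign `ε` ⟺ Kato's λ-inequality
`λ(char 𝐇¹/Z) ≤ λ(char X₀)` on EVERY package of EITHER sign at every frame (the Tate-module instances of the right-hand side
are binders, as in the package facts). `⇒`: the sign is idle, then §3 for each sign (one-sign package fact from the joint one,
`thm62_63_73_signedColemanKato_zeta_of_joint`); `⇐`: specialise to sign `ε`. No image hypothesis.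
[cite: Kobayashi2003, Thm. 7.4 and its proof (p. 13)] [cite: Kato2004Asterisque, Conj. 12.10 (p. 224)] [cite: Serre1972, §1.11 Prop. 12] -/
theorem X7.forall_lamLe_iff_kato_allSigns
    (h12 : Kobayashi2003.thm12_signedSelmerDual_finite_torsion)
    (hper : ∀ [NeZero (W.conductorNorm ℤ)] (f : CuspForm (Gamma0 (W.conductorNorm ℤ)) 2) (ϖ : ℚ),
      IsNewformOf W f → (ϖ : ℝ) * W.realPeriodRat = plusPeriod f → padicValRat p ϖ = 0)
    (hJ : Kobayashi2003.thm62_63_73_signedColemanKato_zetaJoint)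
    (hp : p ≠ 2) (hX : ClassX7 W p) (hap : W.frobeniusTrace p = 0) (ε : ℤˣ) :
    (∀ (κ : ZpExtension ℚ p) (γ : absoluteGaloisGroup ℚ),
        κ.IsCyclotomic → κ.IsTopGenerator γ → IsCyclotomicVariable p γ →
      ∀ [NeZero (W.conductorNorm ℤ)] (f : CuspForm (Gamma0 (W.conductorNorm ℤ)) 2),
        IsNewformOf W f → ∀ (ϖ : ℚ), (ϖ : ℝ) * W.realPeriodRat = plusPeriod f →
      ∀ (Lplus Lminus : IwasawaAlgebra p), IsPollackPair f p Lplus Lminus →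
      ∀ (D : Kobayashi2003.SignedSelmerDualData W κ γ ε) (ξ : IwasawaAlgebra p),
        D.charIdeal = Ideal.span {ξ} → lam (kobayashiL ε Lplus Lminus) ≤ lam ξ) ↔
    ∀ [ContinuousSMul ℤ_[p] (W.tateModule p)] [Module.Free ℤ_[p] (W.tateModule p)]
      [Module.Finite ℤ_[p] (W.tateModule p)],
    ∀ (κ : ZpExtension ℚ p) (γ : absoluteGaloisGroup ℚ),
        κ.IsCyclotomic → κ.IsTopGenerator γ → IsCyclotomicVariable p γ →
      ∀ [NeZero (W.conductorNorm ℤ)] (f : CuspForm (Gamma0 (W.conductorNorm ℤ)) 2),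
        IsNewformOf W f → ∀ (ϖ : ℚ), (ϖ : ℝ) * W.realPeriodRat = plusPeriod f →
      ∀ (ε' : ℤˣ) (I : Kato2004.IwasawaH1Data W p κ γ) (Y : W.FineSelmerDualData κ γ)
        (d : Kobayashi2003.SignedColemanKatoData W p f ϖ κ γ ε' I) (z y : IwasawaAlgebra p),
        Module.charIdeal (IwasawaAlgebra p) (I.H ⧸ d.Z) = Ideal.span {z} →
        Module.charIdeal (IwasawaAlgebra p) Y.X = Ideal.span {y} → lam z ≤ lam y := by
  have hPkg := Kobayashi2003.thm62_63_73_signedColemanKato_zeta_of_joint hJ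
  constructor
  · intro h _ _ _ κ γ hκ hγ hv _ f hf ϖ hϖ ε' I Y d z y hz hy
    have hall := (X7.exists_sign_forall_lamLe_iff_forall_sign W p h12 hper hJ hp hX hap).mp ⟨ε, h⟩
    exact (X7.forall_lamLe_iff_kato W p h12 hper hPkg hp hX hap ε').mp (hall ε')
      κ γ hκ hγ hv f hf ϖ hϖ I Y d z y hz hy
  · intro h
    haveI : ContinuousSMul ℤ_[p] (W.tateModule p) := TateModule.continuousSMul_padicInt
    haveI : Module.Free ℤ_[p] (W.tateModule p) := W.module_free_tateModule_holds p
    haveI : Module.Finite ℤ_[p] (W.tateModule p) := W.module_finite_tateModule_holds p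
    exact (X7.forall_lamLe_iff_kato W p h12 hper hPkg hp hX hap ε).mpr
      fun κ γ hκ hγ hv _ f hf ϖ hϖ I Y d z y hz hy ↦ h κ γ hκ hγ hv f hf ϖ hϖ ε I Y d z y hz hy

/-- **The SIGN-FREE λ-DEFECT, joint package by name** (class X7, odd `p`, `a_p = 0`; `h12`/`hper`/`hJ`): at every frame, the
newform, every period ratio and Pollack pair, for all dual data `D₊` (sign `+1`) and `D₋` (sign `−1`) with generators `ξ₊`,
`ξ₋`: `λ(L_p^+) + λ(ξ₋) = λ(L_p^−) + λ(ξ₊)`, i.e. `λ(L_p^+) − λ(ξ₊) = λ(L_p^−) − λ(ξ₋)`. READING: the EXCESS of analytic over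
algebraic λ is one number per pair (Kato's `λ(char 𝐇¹/Z) − λ(char X₀) ≥ 0`); the λ-stub asks that it be `0`, at whichever sign.
No image hypothesis. [cite: Kobayashi2003, Thm. 5.2 iv) (p. 9), Thm. 7.4 and its proof (p. 13)] [cite: GreenbergVatsal2000, p. 4, (1)–(2)] -/
theorem X7.lam_add_lam_eq_of_signs
    (h12 : Kobayashi2003.thm12_signedSelmerDual_finite_torsion)
    (hper : ∀ [NeZero (W.conductorNorm ℤ)] (f : CuspForm (Gamma0 (W.conductorNorm ℤ)) 2) (ϖ : ℚ),
      IsNewformOf W f → (ϖ : ℝ) * W.realPeriodRat = plusPeriod f → padicValRat p ϖ = 0)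
    (hJ : Kobayashi2003.thm62_63_73_signedColemanKato_zetaJoint)
    (hp : p ≠ 2) (hX : ClassX7 W p) (hap : W.frobeniusTrace p = 0)
    {κ : ZpExtension ℚ p} {γ : absoluteGaloisGroup ℚ} (hκ : κ.IsCyclotomic) (hγ : κ.IsTopGenerator γ)
    (hv : IsCyclotomicVariable p γ) [NeZero (W.conductorNorm ℤ)] {f : CuspForm (Gamma0 (W.conductorNorm ℤ)) 2}
    (hf : IsNewformOf W f) {ϖ : ℚ} (hϖ : (ϖ : ℝ) * W.realPeriodRat = plusPeriod f)
    {Lplus Lminus : IwasawaAlgebra p} (hL : IsPollackPair f p Lplus Lminus)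
    (Dp : Kobayashi2003.SignedSelmerDualData W κ γ 1) (Dm : Kobayashi2003.SignedSelmerDualData W κ γ (-1))
    {ξp ξm : IwasawaAlgebra p} (hξp : Dp.charIdeal = Ideal.span {ξp}) (hξm : Dm.charIdeal = Ideal.span {ξm}) :
    lam (kobayashiL 1 Lplus Lminus) + lam ξm = lam (kobayashiL (-1) Lplus Lminus) + lam ξp := by
  haveI : ContinuousSMul ℤ_[p] (W.tateModule p) := TateModule.continuousSMul_padicInt
  haveI : Module.Free ℤ_[p] (W.tateModule p) := W.module_free_tateModule_holds p
  haveI : Module.Finite ℤ_[p] (W.tateModule p) := W.module_finite_tateModule_holds p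
  obtain ⟨I⟩ := Kato2004.nonempty_iwasawaH1Data_holds W p κ γ hκ hγ
  obtain ⟨dp, dm, hZ⟩ := hJ W p f ϖ κ γ hp hX.1.1 hap hf hϖ hκ hγ hv I
  exact X7.lam_add_lam_eq_of_jointZ W p h12 hper hp hX hap hκ hγ hf hϖ dp dm hZ hL Dp Dm hξp hξm

end X7Named

end Summit.BirchSwinnertonDyer.BirchSwinnertonDyer.Theorems.SmallImageLambdaLowerThreeNsKato

end
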